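/-
Copyright: cell `pub-ymgap` (HUMAN RULING D-0062), Track A of `YM-PLAN.md`, DAG node N20 (= NE7b); R134 acceleration seat
`pub-ymgap-dag-n20-d` (generation 3), module 3.  Released under the licence of the surrounding project.
-/
import Summits.QuantumFields.YangMills.Theorems.BalabanUVNodesN20LCSAvgDomination
import Summits.QuantumFields.YangMills.Theorems.BalabanUVNodesN20LCSAvgDominationRegion
import Summits.QuantumFields.YangMills.Theorems.BalabanUVNodesN20LCSAtRecordLevelZero
import HarnessLib

/-!
# YM-DAG node N20 (= NE7b): (LS) RUNG 1 FOR BAŁABAN'S (0.4) BLOCK AVERAGING — local exponential moments of the plaquette energies of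
# the ONCE-AVERAGED field `Ū = avgFun expMeanLogSU U` under the level-0 lattice Yang–Mills measure, uniformly in `β ≥ 4N` and in the volume,
# and the Peierls consequence (coarse large-field sparseness for the averaging of record)

Track A of `YM-PLAN.md` (cell `pub-ymgap`, HUMAN RULING D-0062), node **N20** = spine estimate NE7b (`T4WeightBudget.RelWeightBound`, NOT PRINTED,
NOT PROVED).  Seat `pub-ymgap-dag-n20-d` (R134), generation 3, module 3; kernel theorems only (0 `def`, 0 `sorry`, standard axioms); COUNT-NEUTRAL.

WHAT.  Modules 1–2 of this seat (`…N20LCSAvgDomination`: the domination letter `1 − reTr Ū(∂p′) ≤ 2N·C_L²·Σ_{q∈R}(1 − reTr U(∂q))` on fields small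
on a box region `R ∋` the plaquettes near `p′`, `C_L = L² + 6((d+2)L)²`; `…N20LCSAvgDominationRegion`: the box regions `boxRegion (emb p′₋) ρ`, their size
and multiplicity `≤ (2ρ+1)^d·d²`) are composed here with seat `pub-ymgap-dag-n20-c`'s (LS) rung 0 at the record's level-0 torus
(`N20LCSAtRecordLevelZero.localExpMoment_gibbsMeasure`: `∫ exp(aβ·Σ_{q∈X}(1 − reTr U(∂q))) d(gibbsMeasure P β) ≤ exp(C·a·#X)`, `β ≥ 4N`, `a ≤ 1∕12`)
and its transfer lemmas (`N20LCSPushforward.twoRegime_le_mul_sum`, `sum_sum_le_mul_sum_biUnion`, `card_biUnion_le_mul`), exactly along the road of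
`N20LCSPushforward.localExpMoment_blockMap` but in the `Setup` currency of the record (no `GaugeConfig` junction needed):

* §1 **`one_sub_reTr_plaqHol_avgFun_le_twoRegime`** — the UNCONDITIONAL linear letter: for `R ⊇` the plaquettes cornered in the `ℓ∞`-ball of radius
  `(d+3)L + 2` around `emb p′₋` and any `α > 0` with `(((d+2)L)²/4)·√(2Nα) < δ_N`, `1 − reTr Ū(∂p′) ≤ (2N·C_L² + 2∕α)·Σ_{q∈R}(1 − reTr U(∂q))`
  (small-field branch = module 1; large-field branch pays `2 ≤ (2∕α)·α`);
* §2 **`sum_one_sub_reTr_plaqHol_avgFun_le`** — summed over a finite family `Q` of coarse plaquettes with the box regions: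
  `Σ_{p′∈Q}(1 − reTr Ū(∂p′)) ≤ (2N·C_L² + 2∕α)·(2ρ+1)^d d²·Σ_{q ∈ ⋃_{p′∈Q} boxRegion (emb p′₋) ρ}(1 − reTr U(∂q))`, `ρ = (d+3)L + 2` (multiplicity, module 2);
* §3 **`localExpMoment_avgFun`** — (LS) RUNG 1 FOR THE AVERAGING OF RECORD (`d = 4`, `G = SU(N)`): for every `N ≥ 1` and `L` there are `δ₀ > 0` and
  `C ≥ 0` such that for every parameter set `P` with `P.d = 4`, `P.L = L`, `1 ≤ m + K`, every `β ≥ 4N`, every `0 ≤ δ ≤ δ₀` and every finite set `Q`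
  of level-1 plaquettes, `∫ exp(δβ·Σ_{p′∈Q}(1 − reTr Ū(∂p′))) d(gibbsMeasure P β) ≤ exp(C·δ·#Q)` — the plaquette energies of the once-averaged
  field have LOCAL EXPONENTIAL MOMENTS at the natural scale `1∕β`, uniformly in `β ≥ 4N` and in the volume; `δ₀`, `C` explicit in `N`, `L` and
  rung 0's constant;
* §4 **`gibbsMeasure_largeField_avgFun_le`** — the PEIERLS CONSEQUENCE (Markov on §3, `N20LCSCoarseSparseness.measureReal_forall_le_le_of_expMoment`):
  `gibbsMeasure P β {U | ∀ p′ ∈ Y, ε ≤ 1 − reTr Ū(∂p′)} ≤ exp(C·δ₀·#Y)·exp(−δ₀·β·ε·#Y)` — coarse large-field SPARSENESS for the averaging of record,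
  the level-1 twin of print's `p₀(g)`-extraction [Balaban1989LargeFieldI] (0.1) (level 0: `N20LCSAtRecordLevelZero.gibbsMeasure_largeField_le`;
  decimation: `N20LCSCoarseSparseness.coarseLargeFieldSparse_blockSquares`).

v1.1 (APPEND-ONLY, every v1 declaration byte-identical): §5 **`gibbsMeasure_largeField_dist1_avgFun_le`** — the same sparseness in the SIZE
currency `|Ū(∂p′) − 1| ≥ ε` of [Balaban1987RG1]'s small-field conditions (`PlaqSmall`), threshold `ε²∕(2N)` via `cmp'_specialUnitaryGroup`
(`sq_div_le_one_sub_reTr_of_le_dist1`).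

HONEST FRAMING.  This is the (LS)₀ ⇒ (LS)₁ transfer of the node's s1 column carried out for Bałaban's ACTUAL averaging operation (the operation of
`Node00.avOfRecord`) instead of decimation ∕ Wilson loops (n20-c modules 2, 5); it is a bound under the UNRESTRICTED level-0 measure (the
CONDITIONAL ∕ small-field-restricted form «in the history term's own state» is n20-c's residual (ii), not touched), at the first averaged level
only (levels `≥ 2` with large-field histories are the (A1c) object, residual (iv)), with crude constants.  NE7b NOT PRINTED ∕ NOT PROVED;
(α)-instance 0∕1; N20 NOT discharged; typed 28∕28, discharged count untouched; one finite four-torus at fixed `ε` — NOT ℝ⁴, NOT infinite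
volume, NOT OS, NOT a mass gap, NOT Clay.

References: T. Bałaban, CMP 98 (1985) 17–51 [Balaban1985Averaging] (Prop. 1 (51) p.26); CMP 109 (1987) 249–301 [Balaban1987RG1] ((0.4) p.253);
CMP 122 (1989) 175–202 [Balaban1989LargeFieldI] ((0.1) p.175: the `p₀(g)`-extraction this rung feeds).
-/

noncomputable section

open scoped BigOperators Matrix.Norms.L2Operator

namespace Summit.QuantumFields.YangMills.BalabanUVNodes.N20LCSAvgExpMoment

open MeasureTheory
open Literature.MathematicalPhysics.QuantumFieldTheory.Balaban1983to89
open T4Continuum T4ReflectionCone BlockAveraging ExpMeanLog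
open Summit.QuantumFields.YangMills.BalabanUVNodes.N20LCSAvgDomination (one_sub_reTr_plaqHol_avgFun_le_mul_sum_of_box)
open Summit.QuantumFields.YangMills.BalabanUVNodes.N20LCSAvgDominationRegion
  (boxRegion mem_boxRegion_of_corner card_boxRegion_le card_filter_mem_boxRegion_emb_le)
open Summit.QuantumFields.YangMills.BalabanUVNodes.N20LCSPushforward (twoRegime_le_mul_sum sum_sum_le_mul_sum_biUnion card_biUnion_le_mul)
open Summit.QuantumFields.YangMills.BalabanUVNodes.N20LCSAtRecordLevelZero (localExpMoment_gibbsMeasure)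

/-! ## §1 The unconditional linear letter (two regimes) -/

section Pointwise

variable {n : Type*} [Fintype n] [DecidableEq n] [Nonempty n] {P : Params} {j : ℕ}

/-- **THE UNCONDITIONAL LINEAR DOMINATION LETTER FOR THE (0.4) AVERAGING** (standing range; `SU(N)`): for any finite `R` containing the plaquettes
cornered in the `ℓ∞`-ball of radius `(d+3)L + 2` around `emb p′₋` and any `α > 0` with `(((d+2)L)²/4)·√(2Nα) < δ_N`,
`1 − reTr Ū(∂p′) ≤ (2N·(L² + 6((d+2)L)²)² + 2∕α)·Σ_{q∈R}(1 − reTr U(∂q))` — no smallness assumed (module 1's letter on small fields; off them some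
`q ∈ R` has energy `> α` and the energy `≤ 2` of `Ū(∂p′)` is paid by `(2∕α)·α`). [cite: Balaban1985Averaging, Prop. 1 (51) p.26; Balaban1987RG1, (0.4) p.253] -/
theorem one_sub_reTr_plaqHol_avgFun_le_twoRegime (hj : j + 1 ≤ P.m + P.K) {α : ℝ} (hα : 0 < α)
    (hguard : ((((P.d + 2) * P.L : ℕ) : ℝ) ^ 2 / 4) * Real.sqrt (2 * (Fintype.card n : ℝ) * α) < deltaSU n)
    (U : GaugeField P j (Matrix.specialUnitaryGroup n ℂ)) (p : Plaq P (j + 1)) (R : Finset (Plaq P j))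
    (hR : ∀ z : Site P j, (∀ ν, ∃ e : ℤ, |e| ≤ (((P.d + 3) * P.L + 2 : ℕ) : ℤ) ∧ z ν = (emb p.src) ν + (e : ZMod (P.sitesPerDir j))) →
      ∀ (a b : Fin P.d) (h : a < b), (⟨z, a, b, h⟩ : Plaq P j) ∈ R) :
    1 - reTr (GaugeField.plaqHol (avgFun (expMeanLogSU (n := n)) U) p) ≤
      (2 * (Fintype.card n : ℝ) * ((P.L : ℝ) ^ 2 + 6 * (((P.d + 2) * P.L : ℕ) : ℝ) ^ 2) ^ 2 + 2 / α) *
        ∑ q ∈ R, (1 - reTr (GaugeField.plaqHol U q)) := by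
  refine twoRegime_le_mul_sum R (fun q => 1 - reTr (GaugeField.plaqHol U q))
    (fun q _ => (RegularGaugeGroup.one_sub_reTr_mem_Icc _).1) hα (by positivity) zero_le_two (fun hsmall => ?_)
    (RegularGaugeGroup.one_sub_reTr_mem_Icc _).2
  exact one_sub_reTr_plaqHol_avgFun_le_mul_sum_of_box (n := n) hj hguard p R hR hsmall

end Pointwise

/-! ## §2 Summed over a family of coarse plaquettes, with the box regions -/

section Summed

variable {n : Type*} [Fintype n] [DecidableEq n] [Nonempty n] {P : Params} {j : ℕ}

open scoped Classical in
/-- **THE SUMMED LETTER**: with `ρ = (d+3)L + 2` and the box regions `R(p′) = boxRegion (emb p′₋) ρ` of module 2 (multiplicity `≤ (2ρ+1)^d·d²`),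
`Σ_{p′∈Q}(1 − reTr Ū(∂p′)) ≤ (2N·C_L² + 2∕α)·((2ρ+1)^d·d²)·Σ_{q∈⋃_{p′∈Q}R(p′)}(1 − reTr U(∂q))`. [cite: Balaban1987RG1, (0.4) p.253] -/
theorem sum_one_sub_reTr_plaqHol_avgFun_le (hj : j + 1 ≤ P.m + P.K) {α : ℝ} (hα : 0 < α)
    (hguard : ((((P.d + 2) * P.L : ℕ) : ℝ) ^ 2 / 4) * Real.sqrt (2 * (Fintype.card n : ℝ) * α) < deltaSU n)
    (U : GaugeField P j (Matrix.specialUnitaryGroup n ℂ)) (Q : Finset (Plaq P (j + 1))) :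
    ∑ p ∈ Q, (1 - reTr (GaugeField.plaqHol (avgFun (expMeanLogSU (n := n)) U) p)) ≤
      (2 * (Fintype.card n : ℝ) * ((P.L : ℝ) ^ 2 + 6 * (((P.d + 2) * P.L : ℕ) : ℝ) ^ 2) ^ 2 + 2 / α) *
        ((2 * ((P.d + 3) * P.L + 2) + 1) ^ P.d * P.d ^ 2 : ℕ) *
        ∑ q ∈ Q.biUnion (fun p => boxRegion (emb p.src) ((P.d + 3) * P.L + 2)), (1 - reTr (GaugeField.plaqHol U q)) := by
  set ρ : ℕ := (P.d + 3) * P.L + 2 with hρ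
  set A : ℝ := 2 * (Fintype.card n : ℝ) * ((P.L : ℝ) ^ 2 + 6 * (((P.d + 2) * P.L : ℕ) : ℝ) ^ 2) ^ 2 + 2 / α with hA
  have hA0 : 0 ≤ A := by positivity
  -- pointwise letter at every coarse plaquette, with its own box region
  have hpt : ∀ p ∈ Q, 1 - reTr (GaugeField.plaqHol (avgFun (expMeanLogSU (n := n)) U) p) ≤
      A * ∑ q ∈ boxRegion (emb p.src) ρ, (1 - reTr (GaugeField.plaqHol U q)) :=
    fun p _ => one_sub_reTr_plaqHol_avgFun_le_twoRegime (n := n) hj hα hguard U p _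
      (fun z hz a b h => mem_boxRegion_of_corner z hz a b h)
  -- multiplicity of the box regions around the block centres
  have hmult : ∀ q ∈ Q.biUnion (fun p => boxRegion (emb p.src) ρ),
      (Q.filter fun p : Plaq P (j + 1) => q ∈ boxRegion (emb p.src) ρ).card ≤ (2 * ρ + 1) ^ P.d * P.d ^ 2 :=
    fun q _ => card_filter_mem_boxRegion_emb_le hj Q q ρ
  have hsum := sum_sum_le_mul_sum_biUnion Q (fun p => boxRegion (emb p.src) ρ) (fun q => 1 - reTr (GaugeField.plaqHol U q))
    (fun q _ => (RegularGaugeGroup.one_sub_reTr_mem_Icc _).1) _ hmult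
  calc ∑ p ∈ Q, (1 - reTr (GaugeField.plaqHol (avgFun (expMeanLogSU (n := n)) U) p))
      ≤ ∑ p ∈ Q, A * ∑ q ∈ boxRegion (emb p.src) ρ, (1 - reTr (GaugeField.plaqHol U q)) := Finset.sum_le_sum hpt
    _ = A * ∑ p ∈ Q, ∑ q ∈ boxRegion (emb p.src) ρ, (1 - reTr (GaugeField.plaqHol U q)) := by rw [Finset.mul_sum]
    _ ≤ A * ((((2 * ρ + 1) ^ P.d * P.d ^ 2 : ℕ) : ℝ) *
          ∑ q ∈ Q.biUnion (fun p => boxRegion (emb p.src) ρ), (1 - reTr (GaugeField.plaqHol U q))) :=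
        mul_le_mul_of_nonneg_left hsum hA0
    _ = _ := by rw [hρ]; ring

end Summed

/-! ## §3 (LS) rung 1 for the averaging of record: `d = 4`, `G = SU(N)`, the level-0 Gibbs measure -/

section Moment

/-- Measurability of the level-1 carrier composed with the averaging: `U ↦ exp(t·Σ_{p′∈Q}(1 − reTr Ū(∂p′)))`. [folklore] -/
theorem measurable_exp_plaqSum_avgFun {N : ℕ} [NeZero N] (P : Params) (t : ℝ) (Q : Finset (Plaq P 1)) :
    Measurable fun U : GaugeField P 0 (Matrix.specialUnitaryGroup (Fin N) ℂ) =>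
      Real.exp (t * ∑ p ∈ Q, (1 - reTr (GaugeField.plaqHol (avgFun (expMeanLogSU (n := Fin N)) U) p))) := by
  have h1 : Measurable fun V : GaugeField P 1 (Matrix.specialUnitaryGroup (Fin N) ℂ) =>
      Real.exp (t * ∑ p ∈ Q, (1 - reTr (GaugeField.plaqHol V p))) :=
    Real.measurable_exp.comp ((Finset.measurable_sum Q fun p _ =>
      measurable_const.sub (RegularGaugeGroup.measurable_reTr.comp (Missing.measurable_plaqHol p))).const_mul t)
  exact h1.comp (measurable_avgFun (expMeanLogSU (n := Fin N)) measurable_expMeanLogSU_E)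

/-- **(LS) RUNG 1 FOR BAŁABAN'S (0.4) AVERAGING OF RECORD.**  For every `N ≥ 1` and `L` there are `δ₀ > 0` and `C ≥ 0` such that for every
`d = 4` parameter set `P` with `P.L = L` and `1 ≤ m + K`, every `β ≥ 4N`, every `0 ≤ δ ≤ δ₀` and every finite set `Q` of level-1 plaquettes:
`∫ exp(δ·β·Σ_{p′∈Q}(1 − reTr Ū(∂p′))) d(gibbsMeasure P β) ≤ exp(C·δ·#Q)`, `Ū = avgFun expMeanLogSU U` — the plaquette energies of the ONCE-AVERAGED
lattice Yang–Mills field have local exponential moments at scale `1∕β`, uniformly in `β ≥ 4N` and in the volume.  (§2 pointwise, multiplicity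
and size `M = (2ρ+1)^4·16`, `ρ = 7L + 2`; then rung 0 at tilt `a = δ·A·M ≤ 1∕12` on the region `⋃R(p′)` of at most `M·#Q` plaquettes.)
[cite: Balaban1985Averaging, Prop. 1 (51) p.26; Balaban1987RG1, (0.4) p.253; Balaban1989LargeFieldI, (0.1) p.175] -/
theorem localExpMoment_avgFun (N : ℕ) [NeZero N] (L : ℕ) :
    ∃ δ₀ : ℝ, 0 < δ₀ ∧ ∃ C : ℝ, 0 ≤ C ∧ ∀ (P : Params), P.d = 4 → P.L = L → 1 ≤ P.m + P.K →
      ∀ (β : ℝ), 4 * N ≤ β → ∀ (δ : ℝ), 0 ≤ δ → δ ≤ δ₀ → ∀ (Q : Finset (Plaq P 1)),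
        ∫ U, Real.exp (δ * β * ∑ p ∈ Q, (1 - reTr (GaugeField.plaqHol (avgFun (expMeanLogSU (n := Fin N)) U) p)))
            ∂(T4GenFunBounds.gibbsMeasure P β : Measure (GaugeField P 0 (Matrix.specialUnitaryGroup (Fin N) ℂ))) ≤
          Real.exp (C * δ * Q.card) := by
  classical
  obtain ⟨C₀, hC₀, hLS0⟩ := localExpMoment_gibbsMeasure N
  -- the constants (functions of `N`, `L` only)
  set Nr : ℝ := (Fintype.card (Fin N) : ℝ) with hNr
  set κ : ℝ := ((((4 + 2) * L : ℕ) : ℝ) ^ 2 / 4) with hκ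
  set CL : ℝ := (L : ℝ) ^ 2 + 6 * (((4 + 2) * L : ℕ) : ℝ) ^ 2 with hCL
  set α : ℝ := (deltaSU (Fin N) / (2 * (κ + 1))) ^ 2 / (2 * Nr) with hαdef
  set A : ℝ := 2 * Nr * CL ^ 2 + 2 / α with hA
  set M : ℕ := (2 * ((4 + 3) * L + 2) + 1) ^ 4 * 4 ^ 2 with hM
  have hNr0 : 0 < Nr := by rw [hNr]; exact_mod_cast Fintype.card_pos
  have hκ0 : 0 ≤ κ := by positivity
  have hδN := deltaSU_pos (n := Fin N)
  have hα0 : 0 < α := by positivity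
  have hA0 : 0 < A := by positivity
  have hMpos : 0 < M := by positivity
  have hM0 : (0 : ℝ) < (M : ℝ) := by exact_mod_cast hMpos
  -- the guard for `α`: `κ·√(2Nα) = κ·δ_N/(2(κ+1)) < δ_N`
  have hsqrt : Real.sqrt (2 * Nr * α) = deltaSU (Fin N) / (2 * (κ + 1)) := by
    rw [hαdef, mul_div_cancel₀ _ (by positivity : (2 : ℝ) * Nr ≠ 0)]
    exact Real.sqrt_sq (by positivity)
  have hguard : κ * Real.sqrt (2 * Nr * α) < deltaSU (Fin N) := by
    rw [hsqrt]
    have h1 : κ / (2 * (κ + 1)) < 1 := by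
      rw [div_lt_one (by positivity)]; linarith
    calc κ * (deltaSU (Fin N) / (2 * (κ + 1))) = deltaSU (Fin N) * (κ / (2 * (κ + 1))) := by ring
      _ < deltaSU (Fin N) * 1 := mul_lt_mul_of_pos_left h1 hδN
      _ = deltaSU (Fin N) := mul_one _
  refine ⟨1 / (12 * (A * M)), by positivity, C₀ * A * M * M, by positivity, ?_⟩
  intro P hd hL hmK β hβ δ hδ0 hδ1 Q
  have hNpos : (0 : ℝ) < N := Nat.cast_pos.mpr (Nat.pos_of_ne_zero (NeZero.ne N))
  have hβ0 : 0 ≤ β := le_trans (by positivity) hβ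
  have hj : 0 + 1 ≤ P.m + P.K := by simpa using hmK
  -- transporting the constants to `P` (`P.d = 4`, `P.L = L`)
  have hdL1 : ((P.d + 2) * P.L : ℕ) = (4 + 2) * L := by rw [hd, hL]
  have hdL2 : (2 * ((P.d + 3) * P.L + 2) + 1) ^ P.d * P.d ^ 2 = M := by rw [hd, hL]
  have hPL : (P.L : ℝ) = (L : ℝ) := by rw [hL]
  have hguardP : ((((P.d + 2) * P.L : ℕ) : ℝ) ^ 2 / 4) * Real.sqrt (2 * (Fintype.card (Fin N) : ℝ) * α) <
      deltaSU (Fin N) := by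
    rw [hdL1]; exact hguard
  -- the region and the tilt
  set R : Plaq P 1 → Finset (Plaq P 0) := fun p => boxRegion (emb p.src) ((P.d + 3) * P.L + 2) with hR
  set X : Finset (Plaq P 0) := Q.biUnion R with hX
  set a : ℝ := δ * (A * M) with ha
  have ha0 : 0 ≤ a := by positivity
  have ha12 : a ≤ 1 / 12 := by
    rw [ha]
    calc δ * (A * M) ≤ 1 / (12 * (A * M)) * (A * M) := mul_le_mul_of_nonneg_right hδ1 (by positivity)
      _ = 1 / 12 := by field_simp
  -- pointwise: `δβ·Σ_{p′∈Q} e(Ū_{p′}) ≤ aβ·Σ_{q∈X} e(U_q)`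
  have hpt : ∀ U : GaugeField P 0 (Matrix.specialUnitaryGroup (Fin N) ℂ),
      δ * β * ∑ p ∈ Q, (1 - reTr (GaugeField.plaqHol (avgFun (expMeanLogSU (n := Fin N)) U) p)) ≤
        a * β * ∑ q ∈ X, (1 - reTr (GaugeField.plaqHol U q)) := by
    intro U
    have h := sum_one_sub_reTr_plaqHol_avgFun_le (n := Fin N) (P := P) (j := 0) hj hα0 hguardP U Q
    rw [hdL1, hdL2, hPL] at h
    have h' : ∑ p ∈ Q, (1 - reTr (GaugeField.plaqHol (avgFun (expMeanLogSU (n := Fin N)) U) p)) ≤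
        A * M * ∑ q ∈ X, (1 - reTr (GaugeField.plaqHol U q)) := by
      refine h.trans (le_of_eq ?_)
      rw [hA, hCL, hNr, hX, hR]
    have hδβ : 0 ≤ δ * β := mul_nonneg hδ0 hβ0
    calc δ * β * ∑ p ∈ Q, (1 - reTr (GaugeField.plaqHol (avgFun (expMeanLogSU (n := Fin N)) U) p))
        ≤ δ * β * (A * M * ∑ q ∈ X, (1 - reTr (GaugeField.plaqHol U q))) := mul_le_mul_of_nonneg_left h' hδβ
      _ = a * β * ∑ q ∈ X, (1 - reTr (GaugeField.plaqHol U q)) := by rw [ha]; ring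
  -- the dominating carrier is integrable (bounded, measurable, probability measure)
  haveI := T4GenFunBounds.isProbabilityMeasure_gibbsMeasure (G := Matrix.specialUnitaryGroup (Fin N) ℂ) P hβ0
  set μ : Measure (GaugeField P 0 (Matrix.specialUnitaryGroup (Fin N) ℂ)) := T4GenFunBounds.gibbsMeasure P β with hμ
  have hg_int : Integrable (fun U : GaugeField P 0 (Matrix.specialUnitaryGroup (Fin N) ℂ) =>
      Real.exp (a * β * ∑ q ∈ X, (1 - reTr (GaugeField.plaqHol U q)))) μ := by
    refine (integrable_const (Real.exp (|a * β| * (2 * X.card)))).mono'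
      (N20LCSAtRecordLevelZero.measurable_exp_plaqSum P (a * β) X).aestronglyMeasurable (ae_of_all _ fun U => ?_)
    rw [Real.norm_eq_abs]
    exact N20LCSAtRecordLevelZero.abs_exp_plaqSum_le P (a * β) X U
  -- integrate
  have hmono : ∫ U, Real.exp (δ * β * ∑ p ∈ Q, (1 - reTr (GaugeField.plaqHol (avgFun (expMeanLogSU (n := Fin N)) U) p))) ∂μ ≤
      ∫ U, Real.exp (a * β * ∑ q ∈ X, (1 - reTr (GaugeField.plaqHol U q))) ∂μ :=
    integral_mono_of_nonneg (ae_of_all _ fun U => (Real.exp_pos _).le) hg_int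
      (ae_of_all _ fun U => Real.exp_le_exp.mpr (hpt U))
  have hrung0 := hLS0 P hd β hβ a ha0 ha12 X
  -- the region count `#X ≤ M·#Q`
  have hXcard : (X.card : ℝ) ≤ (M : ℝ) * Q.card := by
    have h := card_biUnion_le_mul Q R M fun p _ => by
      have := card_boxRegion_le (emb p.src) ((P.d + 3) * P.L + 2)
      rwa [hdL2] at this
    exact_mod_cast h
  calc ∫ U, Real.exp (δ * β * ∑ p ∈ Q, (1 - reTr (GaugeField.plaqHol (avgFun (expMeanLogSU (n := Fin N)) U) p))) ∂μ
      ≤ ∫ U, Real.exp (a * β * ∑ q ∈ X, (1 - reTr (GaugeField.plaqHol U q))) ∂μ := hmono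
    _ ≤ Real.exp (C₀ * a * X.card) := hrung0
    _ ≤ Real.exp (C₀ * a * ((M : ℝ) * Q.card)) :=
        Real.exp_le_exp.mpr (mul_le_mul_of_nonneg_left hXcard (by positivity))
    _ = Real.exp (C₀ * A * M * M * δ * Q.card) := by rw [ha]; ring_nf

/-- The level-1 carrier is bounded: `|exp(t·Σ_{p′∈Q}(1 − reTr Ū(∂p′)))| ≤ exp(|t|·2·#Q)` (`0 ≤ 1 − reTr ≤ 2`). [folklore] -/
theorem abs_exp_plaqSum_avgFun_le {N : ℕ} [NeZero N] (P : Params) (t : ℝ) (Q : Finset (Plaq P 1))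
    (U : GaugeField P 0 (Matrix.specialUnitaryGroup (Fin N) ℂ)) :
    |Real.exp (t * ∑ p ∈ Q, (1 - reTr (GaugeField.plaqHol (avgFun (expMeanLogSU (n := Fin N)) U) p)))| ≤
      Real.exp (|t| * (2 * Q.card)) := by
  rw [Real.abs_exp]
  refine Real.exp_le_exp.2 ((le_abs_self _).trans ?_)
  rw [abs_mul]
  refine mul_le_mul_of_nonneg_left ?_ (abs_nonneg t)
  have h0 : ∀ p ∈ Q, 0 ≤ 1 - reTr (GaugeField.plaqHol (avgFun (expMeanLogSU (n := Fin N)) U) p) := fun p _ =>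
    (RegularGaugeGroup.one_sub_reTr_mem_Icc _).1
  rw [abs_of_nonneg (Finset.sum_nonneg h0)]
  calc ∑ p ∈ Q, (1 - reTr (GaugeField.plaqHol (avgFun (expMeanLogSU (n := Fin N)) U) p)) ≤ ∑ _p ∈ Q, (2 : ℝ) :=
        Finset.sum_le_sum fun p _ => (RegularGaugeGroup.one_sub_reTr_mem_Icc _).2
    _ = 2 * Q.card := by rw [Finset.sum_const, nsmul_eq_mul]; ring

/-- The level-1 carrier is integrable against the level-0 Gibbs measure (`β ≥ 0`). [folklore] -/
theorem integrable_exp_plaqSum_avgFun {N : ℕ} [NeZero N] (P : Params) {β : ℝ} (hβ : 0 ≤ β) (t : ℝ) (Q : Finset (Plaq P 1)) :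
    Integrable (fun U : GaugeField P 0 (Matrix.specialUnitaryGroup (Fin N) ℂ) =>
        Real.exp (t * ∑ p ∈ Q, (1 - reTr (GaugeField.plaqHol (avgFun (expMeanLogSU (n := Fin N)) U) p))))
      (T4GenFunBounds.gibbsMeasure P β : Measure (GaugeField P 0 (Matrix.specialUnitaryGroup (Fin N) ℂ))) := by
  haveI := T4GenFunBounds.isProbabilityMeasure_gibbsMeasure (G := Matrix.specialUnitaryGroup (Fin N) ℂ) P hβ
  refine (integrable_const (Real.exp (|t| * (2 * Q.card)))).mono'
    (measurable_exp_plaqSum_avgFun P t Q).aestronglyMeasurable (ae_of_all _ fun U => ?_)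
  rw [Real.norm_eq_abs]
  exact abs_exp_plaqSum_avgFun_le P t Q U

end Moment

/-! ## §4 The Peierls consequence: coarse large-field sparseness for the averaging of record -/

section Peierls

open Summit.QuantumFields.YangMills.BalabanUVNodes.N20LCSCoarseSparseness (measureReal_forall_le_le_of_expMoment)

/-- **COARSE LARGE-FIELD SPARSENESS FOR BAŁABAN'S (0.4) AVERAGING** (level 1, under the level-0 lattice Yang–Mills measure): with the `δ₀ > 0`,
`C ≥ 0` of `localExpMoment_avgFun`, for every `d = 4` parameter set `P` (`P.L = L`, `1 ≤ m + K`), every `β ≥ 4N`, every threshold `ε` and every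
finite set `Y` of level-1 plaquettes,
`gibbsMeasure P β {U | ∀ p′ ∈ Y, ε ≤ 1 − reTr Ū(∂p′)} ≤ exp(C·δ₀·#Y)·exp(−δ₀·β·ε·#Y)` — the probability that the ONCE-AVERAGED field is `ε`-large on
all of `Y` decays like `e^{−(δ₀βε − Cδ₀)·#Y}`: the level-1 twin, for the averaging of record, of print's `p₀(g)`-extraction at level 0
([Balaban1989LargeFieldI] (0.1); tree `N20LCSAtRecordLevelZero.gibbsMeasure_largeField_le`) — Markov on the exponential moment of §3.
[cite: Balaban1989LargeFieldI, (0.1) p.175; Balaban1987RG1, (0.4) p.253] -/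
theorem gibbsMeasure_largeField_avgFun_le (N : ℕ) [NeZero N] (L : ℕ) :
    ∃ δ₀ : ℝ, 0 < δ₀ ∧ ∃ C : ℝ, 0 ≤ C ∧ ∀ (P : Params), P.d = 4 → P.L = L → 1 ≤ P.m + P.K →
      ∀ (β : ℝ), 4 * N ≤ β → ∀ (ε : ℝ) (Y : Finset (Plaq P 1)),
        (T4GenFunBounds.gibbsMeasure P β : Measure (GaugeField P 0 (Matrix.specialUnitaryGroup (Fin N) ℂ))).real
            {U | ∀ p ∈ Y, ε ≤ 1 - reTr (GaugeField.plaqHol (avgFun (expMeanLogSU (n := Fin N)) U) p)} ≤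
          Real.exp (C * δ₀ * Y.card) * Real.exp (-(δ₀ * β * ε * Y.card)) := by
  obtain ⟨δ₀, hδ₀, C, hC, h⟩ := localExpMoment_avgFun N L
  refine ⟨δ₀, hδ₀, C, hC, fun P hd hL hmK β hβ ε Y => ?_⟩
  have hNpos : (0 : ℝ) < N := Nat.cast_pos.mpr (Nat.pos_of_ne_zero (NeZero.ne N))
  have hβ0 : 0 ≤ β := le_trans (by positivity) hβ
  haveI := T4GenFunBounds.isProbabilityMeasure_gibbsMeasure (G := Matrix.specialUnitaryGroup (Fin N) ℂ) P hβ0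
  have hmarkov := measureReal_forall_le_le_of_expMoment
    (T4GenFunBounds.gibbsMeasure P β : Measure (GaugeField P 0 (Matrix.specialUnitaryGroup (Fin N) ℂ))) Y
    (fun p U => 1 - reTr (GaugeField.plaqHol (avgFun (expMeanLogSU (n := Fin N)) U) p)) (ε := ε) hδ₀.le hβ0
    (integrable_exp_plaqSum_avgFun P hβ0 (δ₀ * β) Y)
  exact hmarkov.trans (mul_le_mul_of_nonneg_right (h P hd hL hmK β hβ δ₀ hδ₀.le le_rfl Y) (Real.exp_pos _).le)

end Peierls

/-! ## §5 (v1.1) The Peierls consequence in the size currency `|Ū(∂p′) − 1|` of Bałaban's small-field conditions -/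

section PeierlsDist

open Literature.MathematicalPhysics.QuantumFieldTheory.Balaban1983to89.B8Eq110UnitaryProof (cmp'_specialUnitaryGroup)

/-- From a size threshold to an energy threshold on `SU(N)`: `ε ≤ |g − 1|`, `0 ≤ ε` ⇒ `ε²∕(2N) ≤ 1 − reTr g` (tree `cmp'_specialUnitaryGroup`).
[cite: Balaban1985RegularSpaces, (1.10) p.77] -/
theorem sq_div_le_one_sub_reTr_of_le_dist1 {n : Type*} [Fintype n] [DecidableEq n] [Nonempty n]
    (g : Matrix.specialUnitaryGroup n ℂ) {ε : ℝ} (hε : 0 ≤ ε) (h : ε ≤ dist1 g) :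
    ε ^ 2 / (2 * (Fintype.card n : ℝ)) ≤ 1 - reTr g := by
  have hN : (0 : ℝ) < 2 * (Fintype.card n : ℝ) := by
    have : (0 : ℝ) < Fintype.card n := by exact_mod_cast Fintype.card_pos
    linarith
  rw [div_le_iff₀ hN]
  calc ε ^ 2 ≤ dist1 g ^ 2 := pow_le_pow_left₀ hε h 2
    _ ≤ 2 * (Fintype.card n : ℝ) * (1 - reTr g) := cmp'_specialUnitaryGroup g
    _ = (1 - reTr g) * (2 * (Fintype.card n : ℝ)) := by ring

/-- **COARSE LARGE-FIELD SPARSENESS FOR THE AVERAGING OF RECORD, IN THE SIZE CURRENCY** of [Balaban1987RG1]'s small-field conditions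
`|U(∂p) − 1| < ε` (tree `PlaqSmall`): with the `δ₀ > 0`, `C ≥ 0` of `localExpMoment_avgFun`, for every `d = 4` parameter set `P` (`P.L = L`,
`1 ≤ m + K`), every `β ≥ 4N`, every `ε ≥ 0` and every finite set `Y` of level-1 plaquettes,
`gibbsMeasure P β {U | ∀ p′ ∈ Y, ε ≤ |Ū(∂p′) − 1|} ≤ exp(C·δ₀·#Y)·exp(−δ₀·β·(ε²∕(2N))·#Y)` — the event is contained in the energy event of
`gibbsMeasure_largeField_avgFun_le` at threshold `ε²∕(2N)` (`cmp'`). [cite: Balaban1989LargeFieldI, (0.1) p.175; Balaban1987RG1, (0.4) p.253] -/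
theorem gibbsMeasure_largeField_dist1_avgFun_le (N : ℕ) [NeZero N] (L : ℕ) :
    ∃ δ₀ : ℝ, 0 < δ₀ ∧ ∃ C : ℝ, 0 ≤ C ∧ ∀ (P : Params), P.d = 4 → P.L = L → 1 ≤ P.m + P.K →
      ∀ (β : ℝ), 4 * N ≤ β → ∀ (ε : ℝ), 0 ≤ ε → ∀ (Y : Finset (Plaq P 1)),
        (T4GenFunBounds.gibbsMeasure P β : Measure (GaugeField P 0 (Matrix.specialUnitaryGroup (Fin N) ℂ))).real
            {U | ∀ p ∈ Y, ε ≤ dist1 (GaugeField.plaqHol (avgFun (expMeanLogSU (n := Fin N)) U) p)} ≤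
          Real.exp (C * δ₀ * Y.card) * Real.exp (-(δ₀ * β * (ε ^ 2 / (2 * (Fintype.card (Fin N) : ℝ))) * Y.card)) := by
  obtain ⟨δ₀, hδ₀, C, hC, h⟩ := gibbsMeasure_largeField_avgFun_le N L
  refine ⟨δ₀, hδ₀, C, hC, fun P hd hL hmK β hβ ε hε Y => ?_⟩
  have hNpos : (0 : ℝ) < N := Nat.cast_pos.mpr (Nat.pos_of_ne_zero (NeZero.ne N))
  have hβ0 : 0 ≤ β := le_trans (by positivity) hβ
  haveI := T4GenFunBounds.isProbabilityMeasure_gibbsMeasure (G := Matrix.specialUnitaryGroup (Fin N) ℂ) P hβ0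
  have hsub : {U : GaugeField P 0 (Matrix.specialUnitaryGroup (Fin N) ℂ) |
        ∀ p ∈ Y, ε ≤ dist1 (GaugeField.plaqHol (avgFun (expMeanLogSU (n := Fin N)) U) p)} ⊆
      {U | ∀ p ∈ Y, ε ^ 2 / (2 * (Fintype.card (Fin N) : ℝ)) ≤
        1 - reTr (GaugeField.plaqHol (avgFun (expMeanLogSU (n := Fin N)) U) p)} :=
    fun U hU p hp => sq_div_le_one_sub_reTr_of_le_dist1 _ hε (hU p hp)
  exact (measureReal_mono hsub).trans (h P hd hL hmK β hβ _ Y)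

end PeierlsDist

end Summit.QuantumFields.YangMills.BalabanUVNodes.N20LCSAvgExpMoment

end
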